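import Literature.NumberTheory.Automorphic.ArchimedeanEnvelopingAction
import Literature.NumberTheory.Automorphic.AutomorphicRepsGLSatakeFlathProofs
import HarnessLib

/-!
# The span of the automorphic forms consists of automorphic forms (Borel–Jacquet 4.3, first
# assertion): discharge of `mem_automorphicForms_iff` for data with `𝔤 = 𝔤𝔩(N, A)`, e.g. `GL_n`

Topic `NumberTheory/Automorphic`. The space `𝒜 = automorphicForms 𝒟` of `AutomorphicForms` is
the complex span of the automorphic forms (`IsAutomorphicForm 𝒟`: left `G(K)`-invariant, of some
level, smooth and `K_∞`-finite, `Z(𝔤)`-finite, of moderate growth), and the named fact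
`mem_automorphicForms_iff 𝒟` records that its elements are again automorphic forms — i.e. that
sums and scalar multiples of automorphic forms are automorphic (Borel–Jacquet 1979, 4.3: "`𝒜` is
a vector space"; 4.2 with §1.2, §1.3, §1.6) — granted directed levels and finite-dimensional
coefficients. This file PROVES it for automorphy data whose archimedean group is a full linear
group (`𝒟.arch.lie = ⊤`, `𝒟.arch.carrier = ⊤`), in particular for the `GL_n` datum
(`mem_automorphicForms_iff_gl`):

* moderate growth, right invariance under a level and left invariance are linear conditions
  (`HasModerateGrowth.add/smul`, `hasModerateGrowth_zero`; a common level exists by directedness);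
* `K_∞`-finiteness is linear (`isKFinite_of_mem_span` of `AutomorphicRepsGLSatakeFlathProofs`);
* `Z(𝔤)`-finiteness is linear ON SMOOTH FUNCTIONS: for `𝔤 = 𝔤𝔩(N, A)` the word action
  `p φ` (`applyFree`) of `p ∈ ℝ⟨𝔤⟩` on archimedean-smooth `φ` is the action of the image of `p` in
  `U(𝔤)` through the Lie algebra representation on `archSmooth` (`ArchimedeanEnvelopingAction`,
  `coe_envelopingAction_freeToEnveloping`), hence additive in `φ` (`applyFree_add_right_of_top`),
  so `Z(φ + ψ) ⊆ Z φ + Z ψ` for the `Z(𝔤)`-orbit spans (`zOrbitSpan_add_le_of_top`,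
  `IsZFinite.add_of_top`);
* assembly: `isAutomorphicForm_zero`, `IsAutomorphicForm.add_of_top`,
  `IsAutomorphicForm.smul`, `mem_automorphicForms_iff_of_top`, `mem_automorphicForms_iff_gl`, and
  the pointwise corollaries `isAutomorphicForm_of_mem_automorphicForms_gl`,
  `isCuspFormGL_of_mem_cuspFormsGL'` (elements of `𝒜₀` are cusp forms, unconditionally).

Everything here is proved. (For a general linear real group `H` the same holds once
`isArchSmooth_lieDeriv` and `applyFree_congr` are available for `H`; only the full linear group
is treated, which is what the `GL_n` theory uses.)

## References

* A. Borel, H. Jacquet, *Automorphic forms and automorphic representations*, Proc. Sympos. Pure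
  Math. 33 (Corvallis 1977), Part 1 (1979), §1.2, §1.3, §1.6, 4.2, 4.3 [BorelJacquetCorvallis1979].
* J. R. Getz, H. Hahn, *An Introduction to Automorphic Representations*, GTM 300 (2024), Def. 6.5
  ("the `ℂ`-vector space of automorphic forms", p. 118) [GetzHahn2024].
-/

open scoped MatrixGroups Matrix ContDiff Classical
open NumberField

noncomputable section

namespace Literature.NumberTheory.Automorphic

/-! ### 1. `Z(𝔤)`-finiteness is linear on smooth functions (`𝔤 = 𝔤𝔩(N, A)`) -/

section ZFinite

variable {A : Type*} [NormedCommRing A] [NormedAlgebra ℝ A] [NormedAlgebra ℚ A] [CompleteSpace A]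
  [StarRing A] {N : Type*} [Fintype N] [DecidableEq N] {H : RealMatrixGroup A N}
  {G : Type*} [Group G] (ι : H.carrier →* G)

/-- The iterated Lie derivative of a scalar multiple: `w (c φ) = c (w φ)` (no smoothness
needed, `lieDeriv_smul`). Borel–Jacquet 1979, §1.5. [folklore] -/
theorem iterLieDeriv_smul (w : List H.lie) (c : ℂ) (φ : G → ℂ) :
    iterLieDeriv ι w (c • φ) = c • iterLieDeriv ι w φ := by
  induction w with
  | nil => rfl
  | cons X w ih => rw [iterLieDeriv_cons, iterLieDeriv_cons, ih, lieDeriv_smul]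

/-- The word action on a scalar multiple: `p (c φ) = c (p φ)` (no smoothness needed).
Borel–Jacquet 1979, §1.5. [folklore] -/
theorem applyFree_smul_right (p : FreeAlgebra ℝ H.lie) (c : ℂ) (φ : G → ℂ) :
    applyFree ι p (c • φ) = c • applyFree ι p φ := by
  simp only [applyFree, iterLieDeriv_smul, Finsupp.smul_sum, smul_comm c]

/-- The iterated Lie derivatives of the zero function vanish. [folklore] -/
theorem iterLieDeriv_zero (w : List H.lie) : iterLieDeriv ι w (0 : G → ℂ) = 0 := by
  have h := iterLieDeriv_smul ι w 0 (0 : G → ℂ)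
  rwa [zero_smul, zero_smul] at h

/-- The word action kills the zero function: `p 0 = 0`. [folklore] -/
theorem applyFree_zero_right (p : FreeAlgebra ℝ H.lie) : applyFree ι p (0 : G → ℂ) = 0 := by
  have h := applyFree_smul_right ι p 0 (0 : G → ℂ)
  rwa [zero_smul, zero_smul] at h

/-- The zero function is `Z(𝔤)`-finite (its `Z(𝔤)`-orbit span is `0`). [folklore] -/
theorem isZFinite_zero : IsZFinite ι (0 : G → ℂ) := by
  unfold IsZFinite
  have h : zOrbitSpan ι (0 : G → ℂ) ≤ ⊥ := Submodule.span_le.2 (by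
    rintro _ ⟨p, -, rfl⟩
    simp [applyFree_zero_right])
  rw [le_bot_iff.1 h]
  infer_instance

/-- The `Z(𝔤)`-orbit span of a scalar multiple lies in that of the function. [folklore] -/
theorem zOrbitSpan_smul_le (c : ℂ) (φ : G → ℂ) : zOrbitSpan ι (c • φ) ≤ zOrbitSpan ι φ := by
  refine Submodule.span_le.2 ?_
  rintro _ ⟨p, hp, rfl⟩
  rw [SetLike.mem_coe, applyFree_smul_right]
  exact Submodule.smul_mem _ c (Submodule.subset_span ⟨p, hp, rfl⟩)

/-- `Z(𝔤)`-finiteness passes to scalar multiples. Borel–Jacquet 1979, §1.6. [folklore] -/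
theorem IsZFinite.smul (c : ℂ) {φ : G → ℂ} (hφ : IsZFinite ι φ) : IsZFinite ι (c • φ) := by
  unfold IsZFinite at hφ ⊢
  exact Submodule.finiteDimensional_of_le (zOrbitSpan_smul_le ι c φ)

variable [FiniteDimensional ℝ A]

/-- **The word action is additive on smooth functions** for the full linear group
(`H.lie = ⊤`, `H.carrier = ⊤`): `p (φ + ψ) = p φ + p ψ` for archimedean-smooth `φ, ψ` (on smooth
functions `p` acts through the linear endomorphism `envelopingAction (lieDerivRep …) p̄` of
`archSmooth ι`, `coe_envelopingAction_freeToEnveloping`). Borel–Jacquet 1979, §1.5. [cite: BorelJacquetCorvallis1979, §1.5] -/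
theorem applyFree_add_right_of_top (hH : H.lie = ⊤) (hc : H.carrier = ⊤) (p : FreeAlgebra ℝ H.lie)
    {φ ψ : G → ℂ} (hφ : IsArchSmooth ι φ) (hψ : IsArchSmooth ι ψ) :
    applyFree ι p (φ + ψ) = applyFree ι p φ + applyFree ι p ψ := by
  have h := coe_envelopingAction_freeToEnveloping (ι := ι) hH hc p
    ((⟨φ, hφ⟩ : archSmooth ι) + ⟨ψ, hψ⟩)
  rw [map_add, Submodule.coe_add, coe_envelopingAction_freeToEnveloping hH hc p ⟨φ, hφ⟩,
    coe_envelopingAction_freeToEnveloping hH hc p ⟨ψ, hψ⟩] at h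
  exact h.symm

/-- For smooth `φ, ψ` the `Z(𝔤)`-orbit span of `φ + ψ` lies in the sum of those of `φ` and `ψ`
(full linear group). Borel–Jacquet 1979, §1.6. [cite: BorelJacquetCorvallis1979, §1.6] -/
theorem zOrbitSpan_add_le_of_top (hH : H.lie = ⊤) (hc : H.carrier = ⊤) {φ ψ : G → ℂ}
    (hφ : IsArchSmooth ι φ) (hψ : IsArchSmooth ι ψ) :
    zOrbitSpan ι (φ + ψ) ≤ zOrbitSpan ι φ ⊔ zOrbitSpan ι ψ := by
  refine Submodule.span_le.2 ?_
  rintro _ ⟨p, hp, rfl⟩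
  rw [SetLike.mem_coe, applyFree_add_right_of_top ι hH hc p hφ hψ]
  exact Submodule.add_mem_sup (Submodule.subset_span ⟨p, hp, rfl⟩)
    (Submodule.subset_span ⟨p, hp, rfl⟩)

/-- **`Z(𝔤)`-finiteness is additive on smooth functions** (full linear group, finite-dimensional
coefficients). Borel–Jacquet 1979, §1.6 and 4.3. [cite: BorelJacquetCorvallis1979, 4.3] -/
theorem IsZFinite.add_of_top (hH : H.lie = ⊤) (hc : H.carrier = ⊤) {φ ψ : G → ℂ}
    (hφs : IsArchSmooth ι φ) (hψs : IsArchSmooth ι ψ) (hφ : IsZFinite ι φ) (hψ : IsZFinite ι ψ) :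
    IsZFinite ι (φ + ψ) := by
  unfold IsZFinite at hφ hψ ⊢
  haveI : FiniteDimensional ℂ ↥(zOrbitSpan ι φ ⊔ zOrbitSpan ι ψ) :=
    Submodule.finiteDimensional_sup _ _
  exact Submodule.finiteDimensional_of_le (zOrbitSpan_add_le_of_top ι hH hc hφs hψs)

end ZFinite

/-! ### 2. Moderate growth and levels are linear conditions (any automorphy datum) -/

section Growth

variable {K : Type} [Field K] [NumberField K]
  {A : Type*} [NormedCommRing A] [NormedAlgebra ℝ A] [NormedAlgebra ℚ A] [CompleteSpace A]
  [StarRing A] {N : Type*} [Fintype N] [DecidableEq N]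
  {𝒢 : AdelicGroupData K} (𝒟 : AutomorphyDatum 𝒢 A N)

/-- The zero function has moderate growth. Borel–Jacquet 1979, §1.2. [folklore] -/
theorem hasModerateGrowth_zero : HasModerateGrowth 𝒟 (0 : 𝒢.Adelic → ℂ) :=
  ⟨0, 0, fun g ↦ by simp⟩

variable {𝒟}

/-- **Moderate growth is additive**: `C₁ (1 ⊔ ‖g‖)^{r₁} + C₂ (1 ⊔ ‖g‖)^{r₂} ≤
(C₁⁺ + C₂⁺) (1 ⊔ ‖g‖)^{max r₁ r₂}` since `1 ⊔ ‖g‖ ≥ 1`. Borel–Jacquet 1979, §1.2 and 4.2 (d). [cite: BorelJacquetCorvallis1979, §1.2] -/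
theorem HasModerateGrowth.add {φ ψ : 𝒢.Adelic → ℂ} (hφ : HasModerateGrowth 𝒟 φ)
    (hψ : HasModerateGrowth 𝒟 ψ) : HasModerateGrowth 𝒟 (φ + ψ) := by
  obtain ⟨C₁, r₁, h₁⟩ := hφ
  obtain ⟨C₂, r₂, h₂⟩ := hψ
  refine ⟨max C₁ 0 + max C₂ 0, max r₁ r₂, fun g ↦ ?_⟩
  have hb : (1 : ℝ) ≤ 1 ⊔ 𝒟.height g := le_sup_left
  have hb0 : (0 : ℝ) ≤ 1 ⊔ 𝒟.height g := zero_le_one.trans hb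
  have e₁ : C₁ * (1 ⊔ 𝒟.height g) ^ r₁ ≤ max C₁ 0 * (1 ⊔ 𝒟.height g) ^ max r₁ r₂ :=
    (mul_le_mul_of_nonneg_right (le_max_left _ _) (pow_nonneg hb0 _)).trans
      (mul_le_mul_of_nonneg_left (pow_le_pow_right₀ hb (le_max_left _ _)) (le_max_right _ _))
  have e₂ : C₂ * (1 ⊔ 𝒟.height g) ^ r₂ ≤ max C₂ 0 * (1 ⊔ 𝒟.height g) ^ max r₁ r₂ :=
    (mul_le_mul_of_nonneg_right (le_max_left _ _) (pow_nonneg hb0 _)).trans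
      (mul_le_mul_of_nonneg_left (pow_le_pow_right₀ hb (le_max_right _ _)) (le_max_right _ _))
  calc ‖(φ + ψ) g‖ = ‖φ g + ψ g‖ := rfl
    _ ≤ ‖φ g‖ + ‖ψ g‖ := norm_add_le _ _
    _ ≤ C₁ * (1 ⊔ 𝒟.height g) ^ r₁ + C₂ * (1 ⊔ 𝒟.height g) ^ r₂ := add_le_add (h₁ g) (h₂ g)
    _ ≤ max C₁ 0 * (1 ⊔ 𝒟.height g) ^ max r₁ r₂ + max C₂ 0 * (1 ⊔ 𝒟.height g) ^ max r₁ r₂ :=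
        add_le_add e₁ e₂
    _ = (max C₁ 0 + max C₂ 0) * (1 ⊔ 𝒟.height g) ^ max r₁ r₂ := by ring

/-- Moderate growth passes to scalar multiples. Borel–Jacquet 1979, §1.2. [folklore] -/
theorem HasModerateGrowth.smul (c : ℂ) {φ : 𝒢.Adelic → ℂ} (hφ : HasModerateGrowth 𝒟 φ) :
    HasModerateGrowth 𝒟 (c • φ) := by
  obtain ⟨C, r, h⟩ := hφ
  refine ⟨‖c‖ * C, r, fun g ↦ ?_⟩
  calc ‖(c • φ) g‖ = ‖c‖ * ‖φ g‖ := norm_smul c (φ g)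
    _ ≤ ‖c‖ * (C * (1 ⊔ 𝒟.height g) ^ r) := mul_le_mul_of_nonneg_left (h g) (norm_nonneg c)
    _ = ‖c‖ * C * (1 ⊔ 𝒟.height g) ^ r := by ring

/-- Right invariance under a subgroup is inherited by smaller subgroups. [folklore] -/
theorem IsRightInvariantUnder.anti {U V : Subgroup 𝒢.Adelic} (hVU : V ≤ U) {φ : 𝒢.Adelic → ℂ}
    (hφ : IsRightInvariantUnder U φ) : IsRightInvariantUnder V φ :=
  fun u hu g ↦ hφ u (hVU hu) g

/-- Right invariance under a subgroup is additive. [folklore] -/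
theorem IsRightInvariantUnder.add {U : Subgroup 𝒢.Adelic} {φ ψ : 𝒢.Adelic → ℂ}
    (hφ : IsRightInvariantUnder U φ) (hψ : IsRightInvariantUnder U ψ) :
    IsRightInvariantUnder U (φ + ψ) :=
  fun u hu g ↦ by simp only [Pi.add_apply, hφ u hu g, hψ u hu g]

/-- Right invariance under a subgroup passes to scalar multiples. [folklore] -/
theorem IsRightInvariantUnder.smul {U : Subgroup 𝒢.Adelic} (c : ℂ) {φ : 𝒢.Adelic → ℂ}
    (hφ : IsRightInvariantUnder U φ) : IsRightInvariantUnder U (c • φ) :=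
  fun u hu g ↦ by simp only [Pi.smul_apply, hφ u hu g]

end Growth

/-! ### 3. Sums and multiples of automorphic forms; the span (Borel–Jacquet 4.3) -/

section Span

variable {K : Type} [Field K] [NumberField K]
  {A : Type*} [NormedCommRing A] [NormedAlgebra ℝ A] [NormedAlgebra ℚ A] [CompleteSpace A]
  [StarRing A] {N : Type*} [Fintype N] [DecidableEq N]
  {𝒢 : AdelicGroupData K} (𝒟 : AutomorphyDatum 𝒢 A N)

/-- **The zero function is an automorphic form** (every level, `K`- and `Z(𝔤)`-orbit spans
zero, growth constant `0`). Borel–Jacquet 1979, 4.2–4.3. [cite: BorelJacquetCorvallis1979, 4.3] -/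
theorem isAutomorphicForm_zero : IsAutomorphicForm 𝒟 (0 : 𝒢.Adelic → ℂ) where
  leftInvariant _ _ _ := rfl
  exists_level := ⟨_, 𝒟.finiteLevels_nonempty.some_mem, fun _ _ _ ↦ rfl⟩
  archSmooth := (archSmooth 𝒟.ofArch).zero_mem
  kFinite := isKFinite_of_mem_span 𝒟.ofArch (S := {φ | IsKFinite 𝒟.ofArch φ}) (fun _ h ↦ h)
    (Submodule.zero_mem _)
  zFinite := isZFinite_zero 𝒟.ofArch
  moderateGrowth := hasModerateGrowth_zero 𝒟

variable {𝒟}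

/-- **Scalar multiples of automorphic forms are automorphic forms.**
Borel–Jacquet 1979, 4.3. [cite: BorelJacquetCorvallis1979, 4.3] -/
theorem IsAutomorphicForm.smul (c : ℂ) {φ : 𝒢.Adelic → ℂ} (hφ : IsAutomorphicForm 𝒟 φ) :
    IsAutomorphicForm 𝒟 (c • φ) where
  leftInvariant γ hγ g := by simp only [Pi.smul_apply, hφ.leftInvariant γ hγ g]
  exists_level := by
    obtain ⟨U, hU, hφU⟩ := hφ.exists_level
    exact ⟨U, hU, hφU.smul c⟩
  archSmooth := hφ.archSmooth.smul 𝒟.ofArch c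
  kFinite := isKFinite_of_mem_span 𝒟.ofArch (S := {φ | IsKFinite 𝒟.ofArch φ}) (fun _ h ↦ h)
    (Submodule.smul_mem _ c (Submodule.subset_span hφ.kFinite))
  zFinite := hφ.zFinite.smul 𝒟.ofArch c
  moderateGrowth := hφ.moderateGrowth.smul c

/-- **Sums of automorphic forms are automorphic forms**, for a datum whose archimedean group
is a full linear group (`𝒟.arch.lie = ⊤`, `𝒟.arch.carrier = ⊤`) over finite-dimensional
coefficients and with directed levels: left invariance, moderate growth and `K_∞`-finiteness
are linear, a common level exists by directedness, and `Z(𝔤)`-finiteness is additive on smooth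
functions (`IsZFinite.add_of_top`). Borel–Jacquet 1979, 4.3 (first assertion). [cite: BorelJacquetCorvallis1979, 4.3] -/
theorem IsAutomorphicForm.add_of_top [FiniteDimensional ℝ A] (hH : 𝒟.arch.lie = ⊤)
    (hc : 𝒟.arch.carrier = ⊤) (hdir : DirectedOn (· ≥ ·) 𝒟.finiteLevels) {φ ψ : 𝒢.Adelic → ℂ}
    (hφ : IsAutomorphicForm 𝒟 φ) (hψ : IsAutomorphicForm 𝒟 ψ) : IsAutomorphicForm 𝒟 (φ + ψ) where
  leftInvariant γ hγ g := by
    simp only [Pi.add_apply, hφ.leftInvariant γ hγ g, hψ.leftInvariant γ hγ g]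
  exists_level := by
    obtain ⟨U, hU, hφU⟩ := hφ.exists_level
    obtain ⟨V, hV, hψV⟩ := hψ.exists_level
    obtain ⟨W, hW, hWU, hWV⟩ := hdir U hU V hV
    exact ⟨W, hW, (hφU.anti hWU).add (hψV.anti hWV)⟩
  archSmooth := hφ.archSmooth.add 𝒟.ofArch hψ.archSmooth
  kFinite := isKFinite_of_mem_span 𝒟.ofArch (S := {φ | IsKFinite 𝒟.ofArch φ}) (fun _ h ↦ h)
    (Submodule.add_mem _ (Submodule.subset_span hφ.kFinite) (Submodule.subset_span hψ.kFinite))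
  zFinite := hφ.zFinite.add_of_top 𝒟.ofArch hH hc hφ.archSmooth hψ.archSmooth hψ.zFinite
  moderateGrowth := hφ.moderateGrowth.add hψ.moderateGrowth

/-- **Borel–Jacquet 4.3, first assertion, for full linear archimedean groups**: the named fact
`mem_automorphicForms_iff 𝒟` of `AutomorphicForms` holds when `𝒟.arch.lie = ⊤` and
`𝒟.arch.carrier = ⊤` — an element of the span of the automorphic forms is an automorphic form
(span induction with `isAutomorphicForm_zero`, `IsAutomorphicForm.add_of_top`,
`IsAutomorphicForm.smul`). [cite: BorelJacquetCorvallis1979, 4.3] -/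
theorem mem_automorphicForms_iff_of_top (hH : 𝒟.arch.lie = ⊤) (hc : 𝒟.arch.carrier = ⊤) :
    mem_automorphicForms_iff 𝒟 := by
  intro _ hdir φ
  refine ⟨fun hφ ↦ ?_, fun hφ ↦ hφ.mem_automorphicForms⟩
  induction hφ using Submodule.span_induction with
  | mem _ h => exact h
  | zero => exact isAutomorphicForm_zero 𝒟
  | add _ _ _ _ h₁ h₂ => exact h₁.add_of_top hH hc hdir h₂
  | smul c _ _ h => exact h.smul c

end Span

/-! ### 4. The `GL_n` datum -/

section GLn

open NumberField.mixedEmbedding IsDedekindDomain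

variable {n : ℕ} {K : Type} [Field K] [NumberField K]

/-- The levels `{1} × U₀` (`U₀` compact open) of the `GL_n` datum are directed downwards
(`{1} × (U₀ ∩ V₀)` is a level; an open subgroup is closed). Borel–Jacquet 1979, 4.1. [cite: BorelJacquetCorvallis1979, 4.1] -/
theorem directedOn_finiteLevels_gl (hcpt : isCompact_glFiniteIntegralLevel n K) :
    DirectedOn (· ≥ ·) (AutomorphyDatum.gl n K hcpt).finiteLevels := by
  rintro U ⟨U₀, hU₀o, hU₀c, rfl⟩ V ⟨V₀, hV₀o, hV₀c, rfl⟩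
  refine ⟨(U₀ ⊓ V₀).map (GLn.ofFinite n K), ⟨U₀ ⊓ V₀, ?_, ?_, rfl⟩,
    Subgroup.map_mono inf_le_left, Subgroup.map_mono inf_le_right⟩
  · rw [Subgroup.coe_inf]
    exact hU₀o.inter hV₀o
  · rw [Subgroup.coe_inf]
    exact hU₀c.inter_right (V₀.isClosed_of_isOpen hV₀o)

/-- **Borel–Jacquet 4.3, first assertion, for `GL_n`**: the named fact
`mem_automorphicForms_iff (AutomorphyDatum.gl n K hcpt)` holds — the span of the automorphic
forms on `GL_n(𝔸_K)` consists of automorphic forms (`𝔤 = 𝔤𝔩_n(K_∞)` and `G_∞ = GL_n(K_∞)` are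
the full matrix algebra and group, `archGroupGL_lie`, `archGroupGL_carrier`). [cite: BorelJacquetCorvallis1979, 4.3] -/
theorem mem_automorphicForms_iff_gl (hcpt : isCompact_glFiniteIntegralLevel n K) :
    mem_automorphicForms_iff (AutomorphyDatum.gl n K hcpt) :=
  mem_automorphicForms_iff_of_top (𝒟 := AutomorphyDatum.gl n K hcpt) (archGroupGL_lie n K)
    (archGroupGL_carrier n K)

/-- **Elements of `𝒜` on `GL_n(𝔸_K)` are automorphic forms** (pointwise form of
`mem_automorphicForms_iff_gl`; `mixedSpace K` is finite-dimensional and the levels are directed).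
Borel–Jacquet 1979, 4.3. [cite: BorelJacquetCorvallis1979, 4.3] -/
theorem isAutomorphicForm_of_mem_automorphicForms_gl {hcpt : isCompact_glFiniteIntegralLevel n K}
    {φ : (AdelicGroupData.gl n K).Adelic → ℂ} (hφ : φ ∈ automorphicForms (AutomorphyDatum.gl n K hcpt)) :
    IsAutomorphicForm (AutomorphyDatum.gl n K hcpt) φ :=
  (mem_automorphicForms_iff_gl hcpt (directedOn_finiteLevels_gl hcpt) φ).mp hφ

/-- **Elements of the space of cusp forms `𝒜₀` on `GL_n(𝔸_K)` are cusp forms**, unconditionally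
(the cusp conditions are linear, `cuspConditionGL_of_mem_cuspFormsGL`; automorphy by
`mem_automorphicForms_iff_gl`). Borel–Jacquet 1979, 4.3–4.4. [cite: BorelJacquetCorvallis1979, 4.4] -/
theorem isCuspFormGL_of_mem_cuspFormsGL' {hcpt : isCompact_glFiniteIntegralLevel n K}
    {φ : (AdelicGroupData.gl n K).Adelic → ℂ} (hφ : φ ∈ cuspFormsGL n K hcpt) :
    IsCuspFormGL n K hcpt φ :=
  ⟨isAutomorphicForm_of_mem_automorphicForms_gl (cuspFormsGL_le_automorphicForms n K hcpt hφ),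
    fun _ hk hkn ↦ cuspConditionGL_of_mem_cuspFormsGL hφ hk hkn⟩

end GLn

end Literature.NumberTheory.Automorphic
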